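import Literature.NumberTheory.LFunctions.ConreyIwaniec2002Corollary63Large
import Literature.NumberTheory.LFunctions.ConreyIwaniec2002MeanValueDefs
import HarnessLib

/-!
# Conrey–Iwaniec (2002), §6 (6.51): the diagonal of Proposition 6.4 — dyadic blocks

B. Conrey, H. Iwaniec, *Spacing of zeros of Hecke `L`-functions and the class number problem*,
Acta Arith. 103 (2002) 259–312, §6 p. 16–17 [held text `paper:arxiv-math_0111012` p0016–p0017]:
the proof of Proposition 6.4 bounds the diagonal `G = Σ_n |a(n)λ(n)|²n^{-1}` (6.40) of Corollary
6.2, for a cut-off `a` of the class (6.38) with `Y = qT`, by `G ≪ ℒ(T) log q + (q/T)^{1/2}` (6.51)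
"by (6.42) and (6.49)". This file is the dyadic bookkeeping behind (6.51), PROVED, for the cell
`landau-siegel/ls-inputs`, line `thm61-cm-convolution`, registered stub S4 `stub_diagonal` of
SKELETON P64 (closed in the companion file `ConreyIwaniec2002Prop64Diagonal.lean`, which also
holds the two pieces `sum_middle_le`, `sum_topBlock_le`). The only arithmetic input is a block
hypothesis of the shape delivered by the tree's KERNEL theorem
`ConreyIwaniec2002.corollary63_large` (Corollary 6.3 for `X ≥ q²`, remainder `√q·X^{-9/20}`):

* `|a(n)|² ≤ (1 + n/qT + T/n)^{-8}` gives the weights `≤ (n/T)⁸` below `T`, `≤ 1` on `[T, qT]`,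
  `≤ (qT/n)⁸` above `qT` (`normSq_le_of_isCutoff`);
* the block `[T/2^{j+1}, T/2^j]` carries weight `256^{-j}` and Corollary 6.3 with
  `ℒ(T/2^j) ≤ ℒ(T)`, `(T/2^{j+1})^{-9/20} ≤ 2^{j+1}T^{-9/20}` (`sum_bottomBlock_le`); the segment
  `[T, qT]` has `ℒ(qT) = ℒ(T) + L(1,χ)² log q ≤ 2ℒ(T)` (`sum_middle_le`); the block
  `[qT2^m, qT2^{m+1}]` carries weight `256^{-m}` and `ℒ(qT2^{m+1}) ≤ (m+3)ℒ(T)` (`sum_topBlock_le`);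
* the `n ≤ T/2^J < 2q²` trivially (`τ(n,χ)² ≤ n²`, `|a(n)|² ≤ (n/T)⁸`, `T ≥ q³`: `sum_trivial_le`);
  every `n < N` lies in one of these pieces (`mem_dyadicCover`). No lower bound for `L(1,χ)` used.
«The programme SEARCHES and TYPES; no claim about Landau–Siegel zeros, Theorems 1–2 of
arXiv:2211.02515 or a repaired Margin232 until a kernel theorem says so.»

## References

* [ConreyIwaniec2002] B. Conrey, H. Iwaniec, Acta Arith. 103 (2002) 259–312, arXiv:math/0111012:
  §6 (6.38), (6.40), (6.42), Corollary 6.3 (6.49)–(6.50), (6.51), Proposition 6.4.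
-/

noncomputable section

open Complex

namespace Literature.NumberTheory.LFunctions

namespace ConreyIwaniec2002

namespace Prop64Diagonal

/-! ### Elementary lemmas -/

/-- A finite sum over a union is at most the sum of the two sums (non-negative summands;
elementary step of the dyadic summation (6.51)). [cite: ConreyIwaniec2002, §6 (6.51)] -/
theorem sum_union_le_add {s t : Finset ℕ} {f : ℕ → ℝ} (hf : ∀ n, 0 ≤ f n) :
    ∑ n ∈ s ∪ t, f n ≤ ∑ n ∈ s, f n + ∑ n ∈ t, f n := by
  have h := Finset.sum_union_inter (s₁ := s) (s₂ := t) (f := f)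
  have h0 : 0 ≤ ∑ n ∈ s ∩ t, f n := Finset.sum_nonneg fun n _ => hf n
  linarith

/-- A finite sum over a `biUnion` is at most the sum of the sums (non-negative summands;
elementary step of the dyadic summation (6.51)). [cite: ConreyIwaniec2002, §6 (6.51)] -/
theorem sum_biUnion_le_sum {s : Finset ℕ} {t : ℕ → Finset ℕ} {f : ℕ → ℝ}
    (hf : ∀ n, 0 ≤ f n) : ∑ n ∈ s.biUnion t, f n ≤ ∑ i ∈ s, ∑ n ∈ t i, f n := by
  induction s using Finset.induction_on with
  | empty => simp
  | insert i s hi ih =>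
    rw [Finset.biUnion_insert, Finset.sum_insert hi]
    exact (sum_union_le_add hf).trans (by linarith)

/-- `Σ_{k < K} 128^{-k} ≤ 2` (the geometric series of the dyadic summation (6.51)).
[cite: ConreyIwaniec2002, §6 (6.51)] -/
theorem geom_sum_le_two (K : ℕ) : ∑ k ∈ Finset.range K, (1 / 128 : ℝ) ^ k ≤ 2 := by
  have hs := summable_geometric_of_lt_one (by norm_num : (0 : ℝ) ≤ 1 / 128)
    (by norm_num : (1 / 128 : ℝ) < 1)
  calc ∑ k ∈ Finset.range K, (1 / 128 : ℝ) ^ k ≤ ∑' k, (1 / 128 : ℝ) ^ k :=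
        hs.sum_le_tsum (Finset.range K) (fun k _ => by positivity)
    _ = (1 - 1 / 128)⁻¹ := tsum_geometric_of_lt_one (by norm_num) (by norm_num)
    _ ≤ 2 := by norm_num

/-- `(m + 3)·256^{-m} ≤ 3·128^{-m}` (weight of the `m`-th block above `qT` in (6.51)).
[cite: ConreyIwaniec2002, §6 (6.51)] -/
theorem weight_top_le (m : ℕ) : ((m : ℝ) + 3) * (1 / 256 : ℝ) ^ m ≤ 3 * (1 / 128 : ℝ) ^ m := by
  have h1 : (1 / 256 : ℝ) ^ m = (1 / 2 : ℝ) ^ m * (1 / 128 : ℝ) ^ m := by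
    rw [← mul_pow]; norm_num
  have h3 : (m : ℝ) + 3 ≤ 3 * 2 ^ m := by
    have h := Nat.lt_two_pow_self (n := m)
    have h' := Nat.one_le_two_pow (n := m)
    have : m + 3 ≤ 3 * 2 ^ m := by omega
    exact_mod_cast this
  have h2 : ((m : ℝ) + 3) * (1 / 2 : ℝ) ^ m ≤ 3 := by
    rw [one_div_pow, mul_one_div, div_le_iff₀ (by positivity)]
    exact h3
  rw [h1]
  calc ((m : ℝ) + 3) * ((1 / 2 : ℝ) ^ m * (1 / 128 : ℝ) ^ m)
      = (((m : ℝ) + 3) * (1 / 2 : ℝ) ^ m) * (1 / 128 : ℝ) ^ m := by ring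
    _ ≤ 3 * (1 / 128 : ℝ) ^ m := mul_le_mul_of_nonneg_right h2 (by positivity)

/-- `((1/2)^j)⁸ = 256^{-j}` (the block weights of (6.51)). [cite: ConreyIwaniec2002, §6 (6.51)] -/
theorem half_pow_pow_eight (j : ℕ) : ((1 / 2 : ℝ) ^ j) ^ 8 = (1 / 256 : ℝ) ^ j := by
  rw [← pow_mul, mul_comm, pow_mul]; norm_num

/-- `(X/k)^{-9/20} ≤ k·X^{-9/20}` for `X > 0`, `k ≥ 1` (the remainder of (6.49) on the block
`[T/2^{j+1}, T/2^j]`). [cite: ConreyIwaniec2002, §6 (6.49), (6.51)] -/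
theorem div_rpow_neg_le {X k : ℝ} (hX : 0 < X) (hk : 1 ≤ k) :
    (X / k) ^ (-(9 / 20 : ℝ)) ≤ k * X ^ (-(9 / 20 : ℝ)) := by
  have hk0 : 0 < k := by linarith
  rw [Real.div_rpow hX.le hk0.le, Real.rpow_neg hk0.le, div_inv_eq_mul, mul_comm]
  refine mul_le_mul_of_nonneg_right ?_ (Real.rpow_nonneg hX.le _)
  calc k ^ (9 / 20 : ℝ) ≤ k ^ (1 : ℝ) := Real.rpow_le_rpow_of_exponent_le hk (by norm_num)
    _ = k := Real.rpow_one k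

/-! ### The range `q > 4`, `T ≥ q³`, the cut-off weights and `ℒ` -/

/-- Numerics of the range of (6.51): `q ≥ 5`, `q² ≤ T`, `q ≤ T`, `125 ≤ T`, `1 ≤ log q ≤ log T`.
[cite: ConreyIwaniec2002, §6 (6.51)] -/
theorem range_facts {q : ℕ} (hq : 4 < q) {T : ℝ} (hT : (q : ℝ) ^ 3 ≤ T) :
    (5 : ℝ) ≤ q ∧ (q : ℝ) ^ 2 ≤ T ∧ (q : ℝ) ≤ T ∧ 125 ≤ T ∧ 1 ≤ Real.log q ∧
      Real.log q ≤ Real.log T := by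
  have hq5 : (5 : ℝ) ≤ q := by exact_mod_cast hq
  have hq0 : (0 : ℝ) < q := by linarith
  have hq2 : (q : ℝ) ^ 2 ≤ T := le_trans (pow_le_pow_right₀ (by linarith) (by norm_num)) hT
  have hqT : (q : ℝ) ≤ T := le_trans (by nlinarith) hq2
  have h125 : (5 : ℝ) ^ 3 ≤ (q : ℝ) ^ 3 := pow_le_pow_left₀ (by norm_num) hq5 3
  have hT125 : (125 : ℝ) ≤ T := le_trans (by norm_num at h125 ⊢; exact h125) hT
  have hlogq1 : 1 ≤ Real.log q := by
    rw [Real.le_log_iff_exp_le hq0]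
    have := Real.exp_one_lt_d9
    linarith
  exact ⟨hq5, hq2, hqT, hT125, hlogq1, Real.log_le_log hq0 hqT⟩

/-- (6.38) at order `0`, squared: `|a(y)|² ≤ 1`, `≤ (y/T)⁸`, `≤ (Y/y)⁸` (`y, T, Y > 0`).
[cite: ConreyIwaniec2002, Corollary 6.2 (6.38)] -/
theorem normSq_le_of_isCutoff {a : ℝ → ℂ} {T Y y : ℝ} (ha : IsCutoff a T Y) (hT : 0 < T)
    (hY : 0 < Y) (hy : 0 < y) :
    ‖a y‖ ^ 2 ≤ 1 ∧ ‖a y‖ ^ 2 ≤ (y / T) ^ 8 ∧ ‖a y‖ ^ 2 ≤ (Y / y) ^ 8 := by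
  have h0 : ‖a y‖ ≤ ((1 + y / Y + T / y) ^ 4)⁻¹ := by
    simpa using ha.2 0 (by norm_num) y hy
  have hyY : 0 < y / Y := div_pos hy hY
  have hTy : 0 < T / y := div_pos hT hy
  have h1 : ‖a y‖ ≤ 1 := h0.trans (inv_le_one_of_one_le₀ (one_le_pow₀ (by linarith)))
  have h2 : ‖a y‖ ≤ (y / T) ^ 4 := by
    refine h0.trans ?_
    calc ((1 + y / Y + T / y) ^ 4)⁻¹ ≤ ((T / y) ^ 4)⁻¹ :=
          inv_anti₀ (pow_pos hTy 4) (pow_le_pow_left₀ hTy.le (by linarith) 4)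
      _ = (y / T) ^ 4 := by rw [← inv_pow, inv_div]
  have h3 : ‖a y‖ ≤ (Y / y) ^ 4 := by
    refine h0.trans ?_
    calc ((1 + y / Y + T / y) ^ 4)⁻¹ ≤ ((y / Y) ^ 4)⁻¹ :=
          inv_anti₀ (pow_pos hyY 4) (pow_le_pow_left₀ hyY.le (by linarith) 4)
      _ = (Y / y) ^ 4 := by rw [← inv_pow, inv_div]
  have hn := norm_nonneg (a y)
  refine ⟨?_, ?_, ?_⟩
  · calc ‖a y‖ ^ 2 ≤ 1 ^ 2 := pow_le_pow_left₀ hn h1 2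
      _ = 1 := one_pow 2
  · calc ‖a y‖ ^ 2 ≤ ((y / T) ^ 4) ^ 2 := pow_le_pow_left₀ hn h2 2
      _ = (y / T) ^ 8 := by rw [← pow_mul]
  · calc ‖a y‖ ^ 2 ≤ ((Y / y) ^ 4) ^ 2 := pow_le_pow_left₀ hn h3 2
      _ = (Y / y) ^ 8 := by rw [← pow_mul]

/-- A weighted block sum is at most the weight bound times the unweighted one.
[cite: ConreyIwaniec2002, §6 (6.51)] -/
theorem sum_weighted_le {q : ℕ} (χ : DirichletCharacter ℂ q) (a : ℝ → ℂ) {s : Finset ℕ}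
    {w : ℝ} (hw : ∀ n ∈ s, ‖a n‖ ^ 2 ≤ w) :
    ∑ n ∈ s, ‖divisorSumChar χ n‖ ^ 2 * ‖a n‖ ^ 2 / (n : ℝ) ≤
      w * ∑ n ∈ s, ‖divisorSumChar χ n‖ ^ 2 / (n : ℝ) := by
  rw [Finset.mul_sum]
  refine Finset.sum_le_sum fun n hn => ?_
  have hg : 0 ≤ ‖divisorSumChar χ n‖ ^ 2 / (n : ℝ) := by positivity
  calc ‖divisorSumChar χ n‖ ^ 2 * ‖a n‖ ^ 2 / (n : ℝ)
      = ‖a n‖ ^ 2 * (‖divisorSumChar χ n‖ ^ 2 / (n : ℝ)) := by ring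
    _ ≤ w * (‖divisorSumChar χ n‖ ^ 2 / (n : ℝ)) := mul_le_mul_of_nonneg_right (hw n hn) hg

/-- The trivial bound for one term: `τ(n,χ)²|a(n)|²/n ≤ Z⁹/T⁸` when `n ≤ Z`
(`τ(n,χ) ≤ τ(n) ≤ n`, `|a(n)|² ≤ (n/T)⁸`). [cite: ConreyIwaniec2002, §6 (6.38), (6.42)] -/
theorem term_le_of_le {q : ℕ} (χ : DirichletCharacter ℂ q) {a : ℝ → ℂ} {T Y Z : ℝ}
    (ha : IsCutoff a T Y) (hT : 0 < T) (hY : 0 < Y) (hZ : 0 ≤ Z) (n : ℕ) (hn : (n : ℝ) ≤ Z) :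
    ‖divisorSumChar χ n‖ ^ 2 * ‖a n‖ ^ 2 / (n : ℝ) ≤ Z ^ 9 / T ^ 8 := by
  rcases Nat.eq_zero_or_pos n with rfl | hn1
  · simp only [Nat.cast_zero, div_zero]; positivity
  · have hn0 : (0 : ℝ) < n := by exact_mod_cast hn1
    have hτ : ‖divisorSumChar χ n‖ ≤ n :=
      (norm_divisorSumChar_le χ n).trans (by exact_mod_cast Nat.card_divisors_le_self n)
    have ha2 : ‖a n‖ ^ 2 ≤ ((n : ℝ) / T) ^ 8 := (normSq_le_of_isCutoff ha hT hY hn0).2.1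
    calc ‖divisorSumChar χ n‖ ^ 2 * ‖a n‖ ^ 2 / (n : ℝ)
        ≤ (n : ℝ) ^ 2 * ((n : ℝ) / T) ^ 8 / n := by gcongr
      _ = (n : ℝ) ^ 9 / T ^ 8 := by field_simp
      _ ≤ Z ^ 9 / T ^ 8 := by gcongr

/-- `ℒ(cT) = ℒ(T) + L(1,χ)² log c` (`c, T > 0`). [cite: ConreyIwaniec2002, Corollary 6.3 (6.50)] -/
theorem calL_mul {q : ℕ} [NeZero q] (χ : DirichletCharacter ℂ q) {c T : ℝ} (hc : 0 < c)
    (hT : 0 < T) : calL χ (c * T) = calL χ T + ‖χ.LFunction 1‖ ^ 2 * Real.log c := by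
  unfold calL
  rw [Real.log_mul hc.ne' hT.ne']
  ring

/-- `ℒ` in the range of (6.51): `0 ≤ ℒ(T)`, `L(1,χ)² ≤ ℒ(T)`, `L(1,χ)² log q ≤ ℒ(T)` for `q > 4`,
`T ≥ q³`. [cite: ConreyIwaniec2002, Corollary 6.3 (6.50)] -/
theorem calL_facts {q : ℕ} [NeZero q] (χ : DirichletCharacter ℂ q) (hq : 4 < q) {T : ℝ}
    (hT : (q : ℝ) ^ 3 ≤ T) :
    0 ≤ calL χ T ∧ ‖χ.LFunction 1‖ ^ 2 ≤ calL χ T ∧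
      ‖χ.LFunction 1‖ ^ 2 * Real.log q ≤ calL χ T := by
  obtain ⟨_, _, _, hT125, hlogq1, hlogqT⟩ := range_facts hq hT
  have hlogT1 : 1 ≤ Real.log T := hlogq1.trans hlogqT
  have hℓ0 : 0 ≤ ‖χ.LFunction 1‖ := norm_nonneg _
  have hL'0 : 0 ≤ ‖deriv χ.LFunction 1‖ := norm_nonneg _
  have hexp : calL χ T = ‖χ.LFunction 1‖ ^ 2 * Real.log T +
      ‖χ.LFunction 1‖ * ‖deriv χ.LFunction 1‖ := by unfold calL; ring
  have e0 := mul_nonneg hℓ0 hL'0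
  have e1 := mul_le_mul_of_nonneg_left hlogT1 (sq_nonneg ‖χ.LFunction 1‖)
  have e2 := mul_le_mul_of_nonneg_left hlogqT (sq_nonneg ‖χ.LFunction 1‖)
  refine ⟨?_, ?_, ?_⟩
  · rw [hexp]; nlinarith [sq_nonneg ‖χ.LFunction 1‖]
  · rw [hexp]; linarith
  · rw [hexp]; linarith

/-! ### The dyadic covering -/

/-- Every `n < N` lies below `T/2^J`, or in a dyadic block `[T/2^{j+1}, T/2^j]` with `j < J`, or in
`[T, Q]`, or in a dyadic block `[Q2^m, Q2^{m+1}]` with `m < N` (`T > 0`, `Q ≥ 1`): the dyadic covering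
of (6.51). [cite: ConreyIwaniec2002, §6 (6.51)] -/
theorem mem_dyadicCover {T Q : ℝ} (hT : 0 < T) (hQ : 1 ≤ Q) (J N n : ℕ) (hn : n < N) :
    n ∈ Finset.Iic ⌊T / 2 ^ J⌋₊ ∪
        (Finset.range J).biUnion
          (fun j => Finset.Icc ⌈T / 2 ^ (j + 1)⌉₊ ⌊2 * (T / 2 ^ (j + 1))⌋₊) ∪
        Finset.Icc ⌈T⌉₊ ⌊Q⌋₊ ∪
        (Finset.range N).biUnion (fun m => Finset.Icc ⌈Q * 2 ^ m⌉₊ ⌊2 * (Q * 2 ^ m)⌋₊) := by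
  simp only [Finset.mem_union, Finset.mem_biUnion, Finset.mem_range, Finset.mem_Iic,
    Finset.mem_Icc]
  have hx0 : (0 : ℝ) ≤ n := Nat.cast_nonneg n
  by_cases h1 : (n : ℝ) ≤ T / 2 ^ J
  · exact Or.inl (Or.inl (Or.inl (Nat.le_floor h1)))
  by_cases h2 : (n : ℝ) ≤ T
  · push Not at h1
    have hxpos : (0 : ℝ) < n := lt_of_le_of_lt (by positivity) h1
    obtain ⟨i, hi1, hi2⟩ :=
      exists_nat_pow_near (x := T / n) ((one_le_div hxpos).mpr h2) one_lt_two
    have hiJ : i < J := by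
      have hlt : T / n < 2 ^ J := by
        rw [div_lt_iff₀ hxpos]
        rw [div_lt_iff₀ (by positivity)] at h1
        linarith
      exact (pow_lt_pow_iff_right₀ (by norm_num : (1 : ℝ) < 2)).mp (lt_of_le_of_lt hi1 hlt)
    refine Or.inl (Or.inl (Or.inr ⟨i, hiJ, ?_, ?_⟩))
    · refine Nat.ceil_le.mpr ?_
      rw [div_le_iff₀ (by positivity)]
      rw [div_lt_iff₀ hxpos] at hi2
      linarith
    · refine Nat.le_floor ?_
      rw [le_div_iff₀ hxpos] at hi1
      have e : 2 * (T / 2 ^ (i + 1)) = T / 2 ^ i := by rw [pow_succ]; field_simp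
      rw [e, le_div_iff₀ (by positivity)]
      linarith
  by_cases h3 : (n : ℝ) ≤ Q
  · push Not at h2
    exact Or.inl (Or.inr ⟨Nat.ceil_le.mpr h2.le, Nat.le_floor h3⟩)
  · push Not at h3
    have hQ0 : 0 < Q := by linarith
    obtain ⟨m, hm1, hm2⟩ :=
      exists_nat_pow_near (x := (n : ℝ) / Q) ((one_le_div hQ0).mpr h3.le) one_lt_two
    refine Or.inr ⟨m, ?_, ?_, ?_⟩
    · have hxN : (n : ℝ) < N := by exact_mod_cast hn
      have hxQ : (n : ℝ) / Q ≤ n := div_le_self hx0 hQ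
      have hN2 : (N : ℝ) ≤ 2 ^ N := by exact_mod_cast (Nat.lt_two_pow_self (n := N)).le
      have hlt : (2 : ℝ) ^ m < 2 ^ N := by linarith
      exact (pow_lt_pow_iff_right₀ (by norm_num : (1 : ℝ) < 2)).mp hlt
    · refine Nat.ceil_le.mpr ?_
      rw [le_div_iff₀ hQ0] at hm1
      linarith
    · refine Nat.le_floor ?_
      rw [div_lt_iff₀ hQ0, pow_succ] at hm2
      linarith

/-! ### The four pieces -/

/-- **The trivial range** `n ≤ T/2^J < 2q²`: `Σ τ(n,χ)²|a(n)|²/n ≤ 1536 √q·T^{-9/20}`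
(`τ(n,χ)² ≤ n²`, `|a(n)|² ≤ (n/T)⁸`, at most `2q²+1 ≤ 3q²` terms, `q^{20} ≤ T⁷`).
[cite: ConreyIwaniec2002, §6 (6.51)] -/
theorem sum_trivial_le {q : ℕ} [NeZero q] (χ : DirichletCharacter ℂ q) {T : ℝ} {a : ℝ → ℂ}
    (hq : 4 < q) (hT : (q : ℝ) ^ 3 ≤ T) (ha : IsCutoff a T (q * T)) {J : ℕ}
    (hJ2 : T / 2 ^ J < 2 * (q : ℝ) ^ 2) :
    ∑ n ∈ Finset.Iic ⌊T / 2 ^ J⌋₊, ‖divisorSumChar χ n‖ ^ 2 * ‖a n‖ ^ 2 / (n : ℝ) ≤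
      1536 * (Real.sqrt q * T ^ (-(9 / 20 : ℝ))) := by
  obtain ⟨hq5, _, _, hT125, _, _⟩ := range_facts hq hT
  have hq1 : (1 : ℝ) ≤ q := by linarith
  have hT0 : 0 < T := by linarith
  have hT1 : 1 ≤ T := by linarith
  have hqT0 : 0 < (q : ℝ) * T := by positivity
  have hterm : ∀ n ∈ Finset.Iic ⌊T / 2 ^ J⌋₊,
      ‖divisorSumChar χ n‖ ^ 2 * ‖a n‖ ^ 2 / (n : ℝ) ≤ (2 * (q : ℝ) ^ 2) ^ 9 / T ^ 8 := by
    intro n hn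
    have hnZ : (n : ℝ) ≤ 2 * (q : ℝ) ^ 2 :=
      le_trans ((Nat.le_floor_iff (by positivity)).mp (Finset.mem_Iic.mp hn)) hJ2.le
    exact term_le_of_le χ ha hT0 hqT0 (by positivity) n hnZ
  have hcard : ((Finset.Iic ⌊T / 2 ^ J⌋₊).card : ℝ) ≤ 3 * (q : ℝ) ^ 2 := by
    rw [Nat.card_Iic]; push_cast
    have := Nat.floor_le (show 0 ≤ T / 2 ^ J by positivity)
    have : (25 : ℝ) ≤ (q : ℝ) ^ 2 := by nlinarith
    linarith
  have h7 : (q : ℝ) ^ 20 ≤ T ^ 7 :=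
    calc (q : ℝ) ^ 20 ≤ (q : ℝ) ^ 21 := pow_le_pow_right₀ hq1 (by norm_num)
      _ = ((q : ℝ) ^ 3) ^ 7 := by ring
      _ ≤ T ^ 7 := pow_le_pow_left₀ (by positivity) hT 7
  have h1 : (q : ℝ) ^ 20 / T ^ 8 ≤ T⁻¹ :=
    calc (q : ℝ) ^ 20 / T ^ 8 ≤ T ^ 7 / T ^ 8 := div_le_div_of_nonneg_right h7 (by positivity)
      _ = T⁻¹ := by field_simp
  have h2 : T⁻¹ ≤ T ^ (-(9 / 20 : ℝ)) := by
    rw [← Real.rpow_neg_one]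
    exact Real.rpow_le_rpow_of_exponent_le hT1 (by norm_num)
  have h3 : T ^ (-(9 / 20 : ℝ)) ≤ Real.sqrt q * T ^ (-(9 / 20 : ℝ)) :=
    le_mul_of_one_le_left (Real.rpow_nonneg hT0.le _) (Real.one_le_sqrt.mpr hq1)
  calc ∑ n ∈ Finset.Iic ⌊T / 2 ^ J⌋₊, ‖divisorSumChar χ n‖ ^ 2 * ‖a n‖ ^ 2 / (n : ℝ)
      ≤ ∑ n ∈ Finset.Iic ⌊T / 2 ^ J⌋₊, (2 * (q : ℝ) ^ 2) ^ 9 / T ^ 8 := Finset.sum_le_sum hterm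
    _ = (Finset.Iic ⌊T / 2 ^ J⌋₊).card * ((2 * (q : ℝ) ^ 2) ^ 9 / T ^ 8) := by
        rw [Finset.sum_const, nsmul_eq_mul]
    _ ≤ 3 * (q : ℝ) ^ 2 * ((2 * (q : ℝ) ^ 2) ^ 9 / T ^ 8) :=
        mul_le_mul_of_nonneg_right hcard (by positivity)
    _ = 1536 * ((q : ℝ) ^ 20 / T ^ 8) := by ring
    _ ≤ 1536 * (Real.sqrt q * T ^ (-(9 / 20 : ℝ))) := by linarith [h1.trans (h2.trans h3)]

/-- **The blocks below `T`**: for `q² ≤ T/2^J` and `j < J`, the block `[T/2^{j+1}, T/2^j]` has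
`Σ τ(n,χ)²|a(n)|²/n ≤ C(ℒ(T) + 2√q·T^{-9/20})·128^{-j}` (weight `|a(n)|² ≤ 256^{-j}`, Corollary
6.3 on the block, `ℒ(T/2^j) ≤ ℒ(T)`, `log 2 ≤ 1`). [cite: ConreyIwaniec2002, §6 (6.49), (6.51)] -/
theorem sum_bottomBlock_le {q : ℕ} [NeZero q] (χ : DirichletCharacter ℂ q) {T : ℝ} {a : ℝ → ℂ}
    {C : ℝ} (hq : 4 < q) (hT : (q : ℝ) ^ 3 ≤ T) (ha : IsCutoff a T (q * T)) (hC : 0 ≤ C)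
    (hblock : ∀ X : ℝ, (q : ℝ) ^ 2 ≤ X →
      ∑ n ∈ Finset.Icc ⌈X⌉₊ ⌊2 * X⌋₊, ‖divisorSumChar χ n‖ ^ 2 / (n : ℝ) ≤
        C * (calL χ (2 * X) * Real.log 2 + Real.sqrt q * X ^ (-(9 / 20 : ℝ))))
    {J j : ℕ} (hJ : (q : ℝ) ^ 2 ≤ T / 2 ^ J) (hj : j < J) :
    ∑ n ∈ Finset.Icc ⌈T / 2 ^ (j + 1)⌉₊ ⌊2 * (T / 2 ^ (j + 1))⌋₊,
        ‖divisorSumChar χ n‖ ^ 2 * ‖a n‖ ^ 2 / (n : ℝ) ≤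
      C * (calL χ T + 2 * (Real.sqrt q * T ^ (-(9 / 20 : ℝ)))) * (1 / 128 : ℝ) ^ j := by
  obtain ⟨hq5, _, _, hT125, _, _⟩ := range_facts hq hT
  obtain ⟨hℒ0, _, _⟩ := calL_facts χ hq hT
  have hT0 : 0 < T := by linarith
  have hqT0 : 0 < (q : ℝ) * T := by positivity
  set ℒ : ℝ := calL χ T with hℒ
  set R : ℝ := Real.sqrt q * T ^ (-(9 / 20 : ℝ)) with hR
  set X : ℝ := T / 2 ^ (j + 1) with hX
  have hR0 : 0 ≤ R := by rw [hR]; positivity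
  have hlog2 : Real.log 2 ≤ 1 := by
    have := Real.log_le_sub_one_of_pos (by norm_num : (0 : ℝ) < 2); linarith
  have h2X : 2 * X = T / 2 ^ j := by rw [hX, pow_succ]; field_simp
  have hXq : (q : ℝ) ^ 2 ≤ X := by
    have hpow : (2 : ℝ) ^ (j + 1) ≤ 2 ^ J := pow_le_pow_right₀ (by norm_num) hj
    calc (q : ℝ) ^ 2 ≤ T / 2 ^ J := hJ
      _ ≤ T / 2 ^ (j + 1) := div_le_div_of_nonneg_left hT0.le (by positivity) hpow
  have hX0 : 0 < X := by positivity
  -- the weight on the block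
  have hwB : ∀ n ∈ Finset.Icc ⌈X⌉₊ ⌊2 * X⌋₊, ‖a n‖ ^ 2 ≤ (1 / 256 : ℝ) ^ j := by
    intro n hn
    rw [Finset.mem_Icc] at hn
    have hn1 : X ≤ n := Nat.ceil_le.mp hn.1
    have hnpos : (0 : ℝ) < n := lt_of_lt_of_le hX0 hn1
    have hn2 : (n : ℝ) ≤ 2 * X := (Nat.le_floor_iff (by positivity)).mp hn.2
    have hnT : (n : ℝ) / T ≤ (1 / 2 : ℝ) ^ j := by
      rw [h2X] at hn2
      rw [div_le_iff₀ hT0]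
      calc (n : ℝ) ≤ T / 2 ^ j := hn2
        _ = (1 / 2 : ℝ) ^ j * T := by rw [one_div_pow]; field_simp
    calc ‖a n‖ ^ 2 ≤ ((n : ℝ) / T) ^ 8 := (normSq_le_of_isCutoff ha hT0 hqT0 hnpos).2.1
      _ ≤ ((1 / 2 : ℝ) ^ j) ^ 8 := pow_le_pow_left₀ (by positivity) hnT 8
      _ = (1 / 256 : ℝ) ^ j := half_pow_pow_eight j
  -- `ℒ(T/2^j) log 2 ≤ ℒ(T)`
  have hcal : calL χ (2 * X) * Real.log 2 ≤ ℒ := by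
    have hm : calL χ (2 * X) ≤ ℒ := by
      have e : 2 * X = (1 / 2 ^ j) * T := by rw [h2X]; ring
      rw [e, calL_mul χ (by positivity) hT0, ← hℒ]
      have : Real.log (1 / 2 ^ j) ≤ 0 :=
        Real.log_nonpos (by positivity) ((div_le_one (by positivity)).mpr (one_le_pow₀ (by norm_num)))
      nlinarith [sq_nonneg ‖χ.LFunction 1‖]
    have h0 : 0 ≤ calL χ (2 * X) := calL_nonneg χ (by nlinarith)
    calc calL χ (2 * X) * Real.log 2 ≤ calL χ (2 * X) * 1 := mul_le_mul_of_nonneg_left hlog2 h0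
      _ ≤ ℒ := by rw [mul_one]; exact hm
  -- `√q (T/2^{j+1})^{-9/20} ≤ 2^{j+1} √q T^{-9/20}`
  have hrem : Real.sqrt q * X ^ (-(9 / 20 : ℝ)) ≤ 2 ^ (j + 1) * R :=
    calc Real.sqrt q * X ^ (-(9 / 20 : ℝ)) ≤ Real.sqrt q * (2 ^ (j + 1) * T ^ (-(9 / 20 : ℝ))) :=
          mul_le_mul_of_nonneg_left (div_rpow_neg_le hT0 (one_le_pow₀ (by norm_num)))
            (Real.sqrt_nonneg _)
      _ = 2 ^ (j + 1) * R := by rw [hR]; ring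
  have e1 : (1 / 256 : ℝ) ^ j ≤ (1 / 128 : ℝ) ^ j := pow_le_pow_left₀ (by norm_num) (by norm_num) j
  have e2 : (1 / 256 : ℝ) ^ j * 2 ^ (j + 1) = 2 * (1 / 128 : ℝ) ^ j := by
    rw [show (1 / 128 : ℝ) = 1 / 256 * 2 by norm_num, mul_pow, pow_succ]; ring
  have e3 : C * ℒ * (1 / 256 : ℝ) ^ j ≤ C * ℒ * (1 / 128 : ℝ) ^ j :=
    mul_le_mul_of_nonneg_left e1 (mul_nonneg hC hℒ0)
  calc ∑ n ∈ Finset.Icc ⌈X⌉₊ ⌊2 * X⌋₊, ‖divisorSumChar χ n‖ ^ 2 * ‖a n‖ ^ 2 / (n : ℝ)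
      ≤ (1 / 256 : ℝ) ^ j * ∑ n ∈ Finset.Icc ⌈X⌉₊ ⌊2 * X⌋₊, ‖divisorSumChar χ n‖ ^ 2 / (n : ℝ) :=
        sum_weighted_le χ a hwB
    _ ≤ (1 / 256 : ℝ) ^ j *
          (C * (calL χ (2 * X) * Real.log 2 + Real.sqrt q * X ^ (-(9 / 20 : ℝ)))) :=
        mul_le_mul_of_nonneg_left (hblock X hXq) (by positivity)
    _ ≤ (1 / 256 : ℝ) ^ j * (C * (ℒ + 2 ^ (j + 1) * R)) := by gcongr
    _ = C * ℒ * (1 / 256 : ℝ) ^ j + C * R * ((1 / 256 : ℝ) ^ j * 2 ^ (j + 1)) := by ring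
    _ = C * ℒ * (1 / 256 : ℝ) ^ j + C * R * (2 * (1 / 128 : ℝ) ^ j) := by rw [e2]
    _ ≤ C * ℒ * (1 / 128 : ℝ) ^ j + C * R * (2 * (1 / 128 : ℝ) ^ j) := by linarith
    _ = C * (ℒ + 2 * R) * (1 / 128 : ℝ) ^ j := by ring

end Prop64Diagonal

end ConreyIwaniec2002

end Literature.NumberTheory.LFunctions

end
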